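import Literature.AlgebraicGeometry.Motives.BaseChange
import Literature.AlgebraicGeometry.Motives.FamiliesVHS
import HarnessLib

/-!
# The fibre of a base-changed family over an ARBITRARY `L`-point (Görtz–Wedhorn I, Prop. 4.16 / §(4.8))

Topic `Literature/AlgebraicGeometry/Motives` (family `hodge`); sibling of ★ `Motives/FiberBaseChange.lean`, whose
`fiberOverBaseChangeHomIso` treats `L`-points of `S₀ ⊗_σ L` lying over a `k`-RATIONAL point of `S₀`.  Here the point `t` is
arbitrary and the fibre is identified with ANY pullback of `f₀` along the `k`-side reading `Spec L → S₀ ⊗_σ L → S₀` of `t`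
(= `((baseChangeEquiv σ S₀).symm t).left`, ★ `baseChangeEquiv_symm_apply_left`):

* `isPullback_fiberOver_baseChangeHom_map_point` — the fibre of `f₀ ⊗_σ L` over `t` is cartesian over `f₀` along that map;
* `fiberOverBaseChangeIsoOfIsPullback` — hence isomorphic, over `L`, to any `L`-scheme `Y` with a cartesian square
  `IsPullback G Y.hom f₀.left s`, `s = t.left ≫ pr` (stated with `s` a variable so that fine-moduli consumers, whose `s` is
  syntactically `((baseChangeEquiv σ S₀).symm t).left`, apply it through ★ `baseChangeEquiv_symm_apply_left`);
* `fiberOverBaseChangeIsoOfIsPullback_hom_left_comp` — compatibility with the projections to `𝒳₀`.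

Consumer (cell hodgecm-mathlib, rung 0 on `hDel`, W1): the fibre of the complexified universal family of Mumford's fine moduli
scheme over a complex point is the abelian scheme of the triple classified by that point (D4 `classify` gives exactly such a
cartesian square).  Mathlib route: `IsPullback.paste_horiz` + `IsPullback.isoIsPullback`.  No named fact, no `sorry`.

## References
* [GortzWedhorn2020] U. Görtz, T. Wedhorn, *Algebraic Geometry I* (2nd ed. 2020), Prop. 4.16, §(4.8) Def. 4.25.
* [Hartshorne1977] R. Hartshorne, *Algebraic Geometry*, Ch. II §3 p. 89 (fibre of a morphism).
-/

noncomputable section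

open CategoryTheory CategoryTheory.Limits AlgebraicGeometry

universe u

namespace Literature.AlgebraicGeometry.Motives

section FibreOfBaseChangeOverPoint

variable {k L : Type u} [Field k] [Field L] (σ : k →+* L) {𝒳₀ S₀ : SchemeOver k} (f₀ : 𝒳₀ ⟶ S₀)
  (t : AlgPoints ((baseChangeHom σ).obj S₀) L)

/-- `𝒳₀ ⊗_σ L = 𝒳₀ ×_{S₀} (S₀ ⊗_σ L)` (pasting; = ★ `Motives.isPullback_baseChangeHom_map_left`, re-proved to keep the
imports of this section at the level of `Motives/BaseChange`). [folklore] -/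
private theorem isPullback_baseChangeHom_map'' :
    IsPullback (baseChangeHomFst σ 𝒳₀) ((baseChangeHom σ).map f₀).left f₀.left (baseChangeHomFst σ S₀) := by
  have hsnd : ((baseChangeHom σ).map f₀).left ≫ ((baseChangeHom σ).obj S₀).hom =
      ((baseChangeHom σ).obj 𝒳₀).hom := Over.w _
  have outer : IsPullback (baseChangeHomFst σ 𝒳₀)
      (((baseChangeHom σ).map f₀).left ≫ ((baseChangeHom σ).obj S₀).hom)
      (f₀.left ≫ S₀.hom) (Spec.map (CommRingCat.ofHom σ)) := by
    rw [hsnd, Over.w f₀]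
    exact IsPullback.of_hasPullback _ _
  exact outer.of_bot (baseChangeHom_map_left_comp_fst σ f₀).symm (IsPullback.of_hasPullback _ _)

/-- **The fibre of `f₀ ⊗_σ L` over an `L`-point `t` of `S₀ ⊗_σ L` is the fibre product of `f₀` along the `k`-SIDE READING
of `t`**, `Spec L → S₀ ⊗_σ L → S₀` (= `((baseChangeEquiv σ S₀).symm t).left`, ★ `baseChangeEquiv_symm_apply_left`):
pasting the fibre square at `t` with `𝒳₀ ⊗_σ L = 𝒳₀ ×_{S₀} (S₀ ⊗_σ L)` (Görtz–Wedhorn I, Prop. 4.16 / (4.8)).  The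
rational-point case is ★ `isPullback_fiberOver_baseChangeHom_map`. [cite: GortzWedhorn2020, Prop. 4.16 and §(4.8) Def. 4.25] -/
theorem isPullback_fiberOver_baseChangeHom_map_point :
    IsPullback ((fiberι ((baseChangeHom σ).map f₀) t).left ≫ baseChangeHomFst σ 𝒳₀)
      (fiberOverToSpec ((baseChangeHom σ).map f₀) t).left f₀.left (t.left ≫ baseChangeHomFst σ S₀) :=
  (IsPullback.of_hasPullback ((baseChangeHom σ).map f₀).left t.left).paste_horiz (isPullback_baseChangeHom_map'' σ f₀)

/-- The structure map of `Spec L` over itself is the identity (helper). [folklore] -/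
private theorem specOver_self_hom'' (L : Type u) [Field L] : (specOver L L).hom = 𝟙 (specOver L L).left := by
  change Spec.map (CommRingCat.ofHom (algebraMap L L)) = _
  rw [Algebra.algebraMap_self, CommRingCat.ofHom_id, Spec.map_id]
  rfl

/-- The structure map of a fibre is its projection to `Spec L` (helper). [folklore] -/
private theorem fiberOver_hom_eq_left {𝒳 S : SchemeOver L} (f : 𝒳 ⟶ S) (s : AlgPoints S L) :
    (fiberOver f s).hom = (fiberOverToSpec f s).left := by
  rw [← Over.w (fiberOverToSpec f s), specOver_self_hom'']
  exact Category.comp_id _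

/-- **Any pullback of `f₀` along the `k`-side reading of `t` IS the fibre of `f₀ ⊗_σ L` over `t`**, as an `L`-scheme: for
an `L`-scheme `Y` and `G : Y ⟶ 𝒳₀` with `IsPullback G Y.hom f₀.left s`, `s = t.left ≫ pr` (stated with `s` as a variable so that consumers whose `s` is syntactically `((baseChangeEquiv σ S₀).symm t).left` apply it by ★ `baseChangeEquiv_symm_apply_left` without rewriting under binders), `fiberOver (f₀ ⊗_σ L) t ≅ Y` over `L`
(uniqueness of fibre products, `IsPullback.isoIsPullback`).  This is the shape in which a fine-moduli statement
«the triple `P′` over `Spec ℂ` is a pull-back of the universal one along the point `s`» (D4 (R) `IsBaseChangeVia`)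
identifies the fibre of the complexified universal family over `s`. [cite: GortzWedhorn2020, Prop. 4.16 and §(4.8) Def. 4.25]
[cite: Hartshorne1977, Ch. II §3 p. 89 (fibre of a morphism)] -/
noncomputable def fiberOverBaseChangeIsoOfIsPullback (Y : SchemeOver L) (G : Y.left ⟶ 𝒳₀.left)
    (s : Spec (.of L) ⟶ S₀.left) (hs : t.left ≫ baseChangeHomFst σ S₀ = s) (hY : IsPullback G Y.hom f₀.left s) :
    fiberOver ((baseChangeHom σ).map f₀) t ≅ Y :=
  haveI hY' : IsPullback G Y.hom f₀.left (t.left ≫ baseChangeHomFst σ S₀) := hs ▸ hY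
  Over.isoMk ((isPullback_fiberOver_baseChangeHom_map_point σ f₀ t).isoIsPullback _ _ hY') (by
    rw [fiberOver_hom_eq_left]
    exact (isPullback_fiberOver_baseChangeHom_map_point σ f₀ t).isoIsPullback_hom_snd _ _ hY')

/-- Compatibility of `fiberOverBaseChangeIsoOfIsPullback` with the projections to `𝒳₀`:
`fibre ≅ Y → 𝒳₀` equals `fibre → 𝒳₀ ⊗ L → 𝒳₀`. [cite: GortzWedhorn2020, Prop. 4.16] -/
@[reassoc]
theorem fiberOverBaseChangeIsoOfIsPullback_hom_left_comp (Y : SchemeOver L) (G : Y.left ⟶ 𝒳₀.left)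
    (s : Spec (.of L) ⟶ S₀.left) (hs : t.left ≫ baseChangeHomFst σ S₀ = s) (hY : IsPullback G Y.hom f₀.left s) :
    (fiberOverBaseChangeIsoOfIsPullback σ f₀ t Y G s hs hY).hom.left ≫ G =
      (fiberι ((baseChangeHom σ).map f₀) t).left ≫ baseChangeHomFst σ 𝒳₀ := by
  subst hs
  exact (isPullback_fiberOver_baseChangeHom_map_point σ f₀ t).isoIsPullback_hom_fst _ _ hY

end FibreOfBaseChangeOverPoint

end Literature.AlgebraicGeometry.Motives

end
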